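import Summits.CriticalPhenomena.SAWScalingLimit.Theorems.SAWTotalPositivityCriticalBubbleBoundKestenDefs

/-!
# Line `kesten-product-renewal-dictionary` for the crux `SAWTotalPositivity.CriticalBubbleBound`
(stmt-CriticalPhenomena-7117): stub A2 `stub_cutSum` — summing the two-bridge cut

`Σ_N N q_N x_c^N ≤ μ · Σ_h M₂(h)`: given an injective map from the critical polygon classes of `ℤ²`
(canonical SAP words of all lengths, `Negative.CanonSigma`) to apex-meeting, only-apex pairs of bridges of
total length `N + 1` (stub A1 of the line, taken here as a HYPOTHESIS), the polygon normal form of the crux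
(`Negative.polygonSeries`) is bounded by `μ` times the column-sliced disjoint pair mass `Σ_h disjointPairMass h`
of the line's objects (`Theorems/SAWTotalPositivityCriticalBubbleBoundKestenDefs.lean`). Ingredients:
`q_N ≤ #canonSet N` (`Negative.isotropicPolygonCount_le_card_canonSet`), `N x_c^N = μ N x_c^{N+1} ≤
μ (N+1) x_c^{N+1} = μ · pairWeight` (`μ x_c = 1`), push-forward along the injection
(`ENNReal.tsum_comp_le_tsum_of_injective`), and slicing by the apex column (`tsum_goodMass_eq`: a bridge has
span `≥ 0`, so every counted pair lies in exactly one column `h : ℕ`).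

Source of the decomposition: N. Madras, G. Slade, *The Self-Avoiding Walk* (1993), Definitions 1.2.4 and 3.2.2.
-/

noncomputable section

open Literature.Probability.LatticeModels
open Literature.Probability.RandomPlanarGeometry Literature.Probability.RandomPlanarGeometry.SAW
open scoped ENNReal NNReal BigOperators

namespace Summit.CriticalPhenomena.SAWScalingLimit.Theorems.CriticalBubbleBound.Kesten

open Summit.CriticalPhenomena.SAWScalingLimit.Theorems.CriticalBubbleBound.Negative
open Literature.Barriers.CriticalPhenomena (isotropicPolygonCount)

/-! ## Summing the two-bridge cut: `Σ_N N q_N x_c^N ≤ μ · Σ_h M₂(h)` -/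

open Classical in
/-- **Slicing by the apex column**: the mass of the apex-meeting only-apex pairs (`pairWeight` each,
all other pairs `0`) equals `Σ_h M₂(h)` — every such pair lies in exactly one column `h = span ≥ 0`
(`Bridge.span_nonneg`). [folklore] -/
theorem tsum_goodMass_eq :
    ∑' q : BridgePair, (if ApexMeet q ∧ OnlyApex q then pairWeight q else 0) =
      ∑' h : ℕ, disjointPairMass h := by
  classical
  simp only [disjointPairMass]
  rw [ENNReal.tsum_comm]
  refine tsum_congr fun q => ?_
  by_cases hq : ApexMeet q ∧ OnlyApex q
  · set h₀ : ℕ := q.1.span.toNat with hh₀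
    have hspan : ((h₀ : ℕ) : ℤ) = q.1.span := Int.toNat_of_nonneg (Bridge.span_nonneg q.1)
    have key : ∀ h : ℕ, (ApexMeet q ∧ AtHeight h q ∧ OnlyApex q) ↔ h = h₀ := by
      intro h
      constructor
      · rintro ⟨-, hh, -⟩
        have hh' : q.1.span = (h : ℤ) := hh
        have : ((h : ℕ) : ℤ) = ((h₀ : ℕ) : ℤ) := by rw [hspan, hh']
        exact_mod_cast this
      · rintro rfl
        exact ⟨hq.1, hspan.symm, hq.2⟩
    rw [if_pos hq]
    have hfun : (fun h : ℕ => if ApexMeet q ∧ AtHeight h q ∧ OnlyApex q then pairWeight q else 0) =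
        fun h : ℕ => if h = h₀ then pairWeight q else 0 := by
      funext h
      by_cases hh : h = h₀
      · rw [if_pos hh, if_pos ((key h).2 hh)]
      · rw [if_neg hh, if_neg (fun H => hh ((key h).1 H))]
    rw [hfun, tsum_ite_eq]
  · rw [if_neg hq]
    symm
    refine ENNReal.tsum_eq_zero.2 fun h => ?_
    rw [if_neg]
    rintro ⟨h1, -, h3⟩
    exact hq ⟨h1, h3⟩

/-- `x_c^N = μ · x_c^{N+1}` in `ℝ≥0∞` (`μ x_c = 1`). [folklore] -/
theorem ofReal_pow_criticalFugacity_succ (N : ℕ) :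
    ENNReal.ofReal (criticalFugacity ^ N) =
      ENNReal.ofReal connectiveConstant * ENNReal.ofReal (criticalFugacity ^ (N + 1)) := by
  have hx := criticalFugacity_pos_lt_one'.1
  have hxc : criticalFugacity = connectiveConstant⁻¹ := rfl
  have hμ0 : 0 < connectiveConstant := by
    rw [hxc] at hx
    exact inv_pos.1 hx
  rw [← ENNReal.ofReal_mul hμ0.le, pow_succ]
  congr 1
  rw [hxc, ← mul_assoc, mul_comm connectiveConstant, mul_assoc, mul_inv_cancel₀ hμ0.ne', mul_one]

/-- **Stub A2 `stub_cutSum`** of the line `kesten-product-renewal-dictionary`: an injective two-bridge cut of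
the polygon classes (stub A1) gives `Σ_N N q_N x_c^N ≤ μ · Σ_h M₂(h)` — `q_N ≤ #canonSet N`, each class
of length `N` weighs `N x_c^N = μ N x_c^{N+1} ≤ μ (|W₁|+|W₂|) x_c^{|W₁|+|W₂|} = μ · pairWeight`, the
cut is injective into the pairs counted by `Σ_h M₂(h)`. [cite: MadrasSlade1993, Definition 3.2.2] -/
theorem stub_cutSum :
    (∃ g : CanonSigma → BridgePair, Function.Injective g ∧
      ∀ p : CanonSigma, ApexMeet (g p) ∧ OnlyApex (g p) ∧ (g p).1.len + (g p).2.len = p.1 + 1) →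
    polygonSeries ≤ ENNReal.ofReal connectiveConstant * ∑' h : ℕ, disjointPairMass h := by
  classical
  rintro ⟨g, hg, hgood⟩
  have hx0 : 0 ≤ criticalFugacity := criticalFugacity_pos_lt_one'.1.le
  set X : ℕ → ℝ≥0∞ := fun n => ENNReal.ofReal (criticalFugacity ^ n) with hX
  -- the mass of a pair as counted in `Σ_h M₂(h)`
  set G : BridgePair → ℝ≥0∞ := fun q => if ApexMeet q ∧ OnlyApex q then pairWeight q else 0 with hG
  -- Step 1: `N q_N X N ≤ #canonSet N · N · X N = Σ_{w ∈ canonSet N} N X N`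
  have h1 : polygonSeries ≤ ∑' p : CanonSigma, (p.1 : ℝ≥0∞) * X p.1 := by
    rw [polygonSeries, ENNReal.tsum_sigma']
    refine ENNReal.tsum_le_tsum fun N => ?_
    show _ ≤ ∑' b : canonSet N, (N : ℝ≥0∞) * X N
    rw [tsum_fintype, Finset.sum_const, Finset.card_univ, Fintype.card_coe, nsmul_eq_mul]
    have hq := isotropicPolygonCount_le_card_canonSet N
    calc ((N * isotropicPolygonCount N : ℕ) : ℝ≥0∞) * X N
        = (N : ℝ≥0∞) * (isotropicPolygonCount N : ℝ≥0∞) * X N := by push_cast; ring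
      _ ≤ (N : ℝ≥0∞) * ((canonSet N).card : ℝ≥0∞) * X N := by gcongr
      _ = ((canonSet N).card : ℝ≥0∞) * ((N : ℝ≥0∞) * X N) := by ring
  -- Step 2: termwise comparison with the pair weight of the cut
  have h2 : ∀ p : CanonSigma,
      (p.1 : ℝ≥0∞) * X p.1 ≤ ENNReal.ofReal connectiveConstant * G (g p) := by
    intro p
    obtain ⟨hA, hO, hlen⟩ := hgood p
    simp only [hG]
    rw [if_pos ⟨hA, hO⟩, pairWeight]
    have hmass : (g p).1.mass * (g p).2.mass = X (p.1 + 1) := by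
      simp only [Bridge.mass, hX]
      rw [← ENNReal.ofReal_mul (pow_nonneg hx0 _), ← pow_add, hlen]
    have hl : ((g p).1.len : ℝ≥0∞) + ((g p).2.len : ℝ≥0∞) = ((p.1 + 1 : ℕ) : ℝ≥0∞) := by
      rw [← Nat.cast_add, hlen]
    rw [hmass, hl]
    have hstep : X p.1 = ENNReal.ofReal connectiveConstant * X (p.1 + 1) :=
      ofReal_pow_criticalFugacity_succ p.1
    rw [hstep]
    calc (p.1 : ℝ≥0∞) * (ENNReal.ofReal connectiveConstant * X (p.1 + 1))
        = ENNReal.ofReal connectiveConstant * ((p.1 : ℝ≥0∞) * X (p.1 + 1)) := by ring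
      _ ≤ ENNReal.ofReal connectiveConstant * (((p.1 + 1 : ℕ) : ℝ≥0∞) * X (p.1 + 1)) := by
          gcongr
          exact_mod_cast Nat.le_succ _
  -- Step 3: sum, pull out `μ`, push forward along the injective cut, slice by column
  calc polygonSeries ≤ ∑' p : CanonSigma, (p.1 : ℝ≥0∞) * X p.1 := h1
    _ ≤ ∑' p : CanonSigma, ENNReal.ofReal connectiveConstant * G (g p) :=
        ENNReal.tsum_le_tsum h2
    _ = ENNReal.ofReal connectiveConstant * ∑' p : CanonSigma, G (g p) :=
        ENNReal.tsum_mul_left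
    _ ≤ ENNReal.ofReal connectiveConstant * ∑' q : BridgePair, G q := by
        gcongr
        exact ENNReal.tsum_comp_le_tsum_of_injective hg _
    _ = ENNReal.ofReal connectiveConstant * ∑' h : ℕ, disjointPairMass h := by
        rw [hG, tsum_goodMass_eq]

end Summit.CriticalPhenomena.SAWScalingLimit.Theorems.CriticalBubbleBound.Kesten

end
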